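import Mathlib
import Summits.Ventures.PercRepro2.Defs
import Summits.Ventures.PercRepro2.Independence
import Summits.Ventures.PercRepro2.Harris
import Summits.Ventures.PercRepro2.Graph
import Summits.Ventures.PercRepro2.OneColourSwitch

/-!
# Harris on the colouring cube for a decreasing event: `Σ_{ω ∈ A} σ_pq(ω) ≤ 0` (blind cell
PercRepro2, p3 g37, 2026-08-29; `proofs/P3-POCKETRK.md` §3, §5″)

The weight-free form of the lane's Harris–FKG inequality (`Harris.lean`, uniform weights `1/2`):
for an antitone `a`, a monotone `Y` and an antitone `W` on `Config E` with `Σ Y ≤ Σ W`,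
`Σ a · (Y − W) ≤ 0` (`sum_antitone_mul_sub_nonpos`).  With `Y = 1[p ~_Y q]`, `W = 1[p ~_W q]`
(equal totals by the colour flip) this gives, for every DECREASING event `A` of colourings,
`Σ_{ω ∈ A} σ_pq(ω) ≤ 0` (`sum_sigma_pq_of_isLowerSet_nonpos`), in particular for the event
«the `Y`-cluster of `d` avoids the vertex set `F`» (`sum_sigma_pq_of_cluster_disjoint_nonpos`)
— the pocket-cube Harris behind the K-only configurations of a unit with a pocket and the
unpaired lemma.  Own work; std axioms.
-/

namespace Summit.Ventures.PercRepro2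

namespace NoPocket

open Finset Classical OneColourSwitch

variable {E : Type*} [Fintype E] [DecidableEq E]

section Uniform

omit [Fintype E] [DecidableEq E] in
/-- The uniform weights `1/2` are admissible. -/
lemma isProbVec_half : IsProbVec (fun _ : E => (1 / 2 : ℚ)) :=
  ⟨fun _ => by norm_num, fun _ => by norm_num⟩

omit [DecidableEq E] in
/-- Under the uniform weights every colouring has weight `(1/2)^|E|`. -/
lemma weight_half (ω : Config E) :
    weight (fun _ : E => (1 / 2 : ℚ)) ω = (1 / 2 : ℚ) ^ Fintype.card E := by
  simp only [weight, edgeFactor]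
  have : ∀ e : E, (if ω e then (1 / 2 : ℚ) else 1 - 1 / 2) = 1 / 2 := by
    intro e
    split_ifs <;> norm_num
  simp only [this, Finset.prod_const, Finset.card_univ]

/-- The uniform expectation is the normalised sum. -/
lemma expect_half (f : Config E → ℚ) :
    expect (fun _ : E => (1 / 2 : ℚ)) f = (1 / 2 : ℚ) ^ Fintype.card E * ∑ ω, f ω := by
  simp only [expect, weight_half, Finset.mul_sum]

/-- **Harris for a decreasing weight**: for an antitone `a` with non-negative total, a monotone
`Y` and an antitone `W` with `Σ Y ≤ Σ W`, `Σ a · (Y − W) ≤ 0`. -/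
theorem sum_antitone_mul_sub_nonpos {a Y W : Config E → ℚ} (ha : Antitone a) (hY : Monotone Y)
    (hW : Antitone W) (ha0 : 0 ≤ ∑ ω, a ω) (hYW : ∑ ω, Y ω ≤ ∑ ω, W ω) :
    ∑ ω, a ω * (Y ω - W ω) ≤ 0 := by
  set c : ℚ := (1 / 2 : ℚ) ^ Fintype.card E with hc
  have hcpos : 0 < c := by positivity
  -- FKG for `(−a, Y)`: `E[−a] E[Y] ≤ E[−a · Y]`
  have h1 : (c * ∑ ω, -a ω) * (c * ∑ ω, Y ω) ≤ c * ∑ ω, -a ω * Y ω := by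
    have := expect_mul_expect_le_expect_mul isProbVec_half (f := fun ω => -a ω) (g := Y)
      (fun x y hxy => neg_le_neg (ha hxy)) hY
    simpa only [expect_half, Pi.mul_apply] using this
  -- FKG for `(−a, −W)`: `E[−a] E[−W] ≤ E[a · W]`
  have h2 : (c * ∑ ω, -a ω) * (c * ∑ ω, -W ω) ≤ c * ∑ ω, -a ω * -W ω := by
    have := expect_mul_expect_le_expect_mul isProbVec_half (f := fun ω => -a ω)
      (g := fun ω => -W ω) (fun x y hxy => neg_le_neg (ha hxy))
      (fun x y hxy => neg_le_neg (hW hxy))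
    simpa only [expect_half, Pi.mul_apply] using this
  have hs1 : ∑ ω, -a ω = -∑ ω, a ω := by rw [Finset.sum_neg_distrib]
  have hs2 : ∑ ω, -W ω = -∑ ω, W ω := by rw [Finset.sum_neg_distrib]
  have hs3 : ∑ ω, -a ω * Y ω = -∑ ω, a ω * Y ω := by
    rw [← Finset.sum_neg_distrib]
    exact Finset.sum_congr rfl fun ω _ => by ring
  have hs4 : ∑ ω, -a ω * -W ω = ∑ ω, a ω * W ω :=
    Finset.sum_congr rfl fun ω _ => by ring
  rw [hs1, hs3] at h1
  rw [hs1, hs2, hs4] at h2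
  have e1 : ∑ ω, a ω * (Y ω - W ω) = ∑ ω, a ω * Y ω - ∑ ω, a ω * W ω := by
    rw [← Finset.sum_sub_distrib]
    exact Finset.sum_congr rfl fun ω _ => by ring
  rw [e1]
  set SA := ∑ ω, a ω with hSA
  set SY := ∑ ω, Y ω with hSY
  set SW := ∑ ω, W ω with hSW
  set SAY := ∑ ω, a ω * Y ω with hSAY
  set SAW := ∑ ω, a ω * W ω with hSAW
  -- `c · SAY ≤ c · (c · SA · SY)` and `c · (c · SA · SW) ≤ c · SAW`
  have h1' : c * SAY ≤ c * (c * SA * SY) := by nlinarith [h1]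
  have h2' : c * (c * SA * SW) ≤ c * SAW := by nlinarith [h2]
  have h1'' : SAY ≤ c * SA * SY := le_of_mul_le_mul_left h1' hcpos
  have h2'' : c * SA * SW ≤ SAW := le_of_mul_le_mul_left h2' hcpos
  have h3 : c * SA * SY ≤ c * SA * SW :=
    mul_le_mul_of_nonneg_left hYW (mul_nonneg hcpos.le ha0)
  linarith

end Uniform

section Percolation

variable {V : Type*} {ends : E → Sym2 V}

omit [Fintype E] [DecidableEq E] in
/-- The colour flip reverses the order of colourings. -/
lemma compl_le_compl_of_le {ω ω' : Config E} (h : ω ≤ ω') :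
    OneColourSwitch.compl ω' ≤ OneColourSwitch.compl ω := by
  intro e
  have := h e
  simp only [OneColourSwitch.compl]
  revert this
  cases ω e <;> cases ω' e <;> simp

omit [Fintype E] [DecidableEq E] in
/-- The event `p ~_Y q` is increasing. -/
lemma monotone_connY (p q : V) :
    Monotone (fun ω : Config E => if Conn ends ω p q then (1 : ℚ) else 0) := by
  intro ω ω' h
  dsimp only
  by_cases hc : Conn ends ω p q
  · rw [if_pos hc, if_pos (conn_mono h hc)]
  · rw [if_neg hc]
    split_ifs <;> norm_num

omit [Fintype E] [DecidableEq E] in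
/-- The event `p ~_W q` is decreasing. -/
lemma antitone_connW (p q : V) :
    Antitone (fun ω : Config E => if Conn ends (OneColourSwitch.compl ω) p q then (1 : ℚ)
      else 0) := by
  intro ω ω' h
  dsimp only
  by_cases hc : Conn ends (OneColourSwitch.compl ω') p q
  · rw [if_pos hc, if_pos (conn_mono (compl_le_compl_of_le h) hc)]
  · rw [if_neg hc]
    split_ifs <;> norm_num

/-- The totals of `p ~_Y q` and `p ~_W q` agree (the colour flip). -/
lemma sum_connY_eq_sum_connW (p q : V) :
    (∑ ω : Config E, if Conn ends ω p q then (1 : ℚ) else 0) =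
      ∑ ω : Config E, if Conn ends (OneColourSwitch.compl ω) p q then (1 : ℚ) else 0 := by
  have h := Equiv.sum_comp (complPerm (E := E))
    (fun ω : Config E => if Conn ends ω p q then (1 : ℚ) else 0)
  rw [← h]
  rfl

omit [Fintype E] [DecidableEq E] in
/-- `σ_pq` as a rational: the difference of the two connection indicators. -/
lemma sigma_cast (ω : Config E) (p q : V) :
    ((sigma ends ω p q : ℤ) : ℚ) = (if Conn ends ω p q then (1 : ℚ) else 0) -
      (if Conn ends (OneColourSwitch.compl ω) p q then (1 : ℚ) else 0) := by
  simp only [sigma]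
  split_ifs <;> norm_num

/-- **Harris on the colouring cube for a decreasing event**: `Σ_{ω ∈ A} σ_pq(ω) ≤ 0` for every
lower set `A` of colourings (in the product order, `false < true`). -/
theorem sum_sigma_pq_of_isLowerSet_nonpos {A : Set (Config E)} (hA : IsLowerSet A) (p q : V) :
    (∑ ω : Config E, if ω ∈ A then sigma ends ω p q else 0) ≤ 0 := by
  have key := sum_antitone_mul_sub_nonpos (E := E)
    (a := fun ω => if ω ∈ A then (1 : ℚ) else 0)
    (Y := fun ω => if Conn ends ω p q then (1 : ℚ) else 0)
    (W := fun ω => if Conn ends (OneColourSwitch.compl ω) p q then (1 : ℚ) else 0)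
    (fun ω ω' h => by
      dsimp only
      by_cases hm : ω' ∈ A
      · rw [if_pos hm, if_pos (hA h hm)]
      · rw [if_neg hm]
        split_ifs <;> norm_num)
    (monotone_connY p q) (antitone_connW p q)
    (Finset.sum_nonneg fun ω _ => by split_ifs <;> norm_num)
    (sum_connY_eq_sum_connW p q).le
  have hcast : (((∑ ω : Config E, if ω ∈ A then sigma ends ω p q else 0 : ℤ)) : ℚ) =
      ∑ ω : Config E, (if ω ∈ A then (1 : ℚ) else 0) *
        ((if Conn ends ω p q then (1 : ℚ) else 0) -
          (if Conn ends (OneColourSwitch.compl ω) p q then (1 : ℚ) else 0)) := by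
    push_cast
    refine Finset.sum_congr rfl fun ω _ => ?_
    by_cases hm : ω ∈ A
    · rw [if_pos hm, if_pos hm, one_mul, sigma_cast]
    · rw [if_neg hm, if_neg hm, zero_mul]
  have : (((∑ ω : Config E, if ω ∈ A then sigma ends ω p q else 0 : ℤ)) : ℚ) ≤ 0 := by
    rw [hcast]; exact key
  exact_mod_cast this

omit [Fintype E] [DecidableEq E] in
/-- «The `Y`-cluster of `d` is disjoint from `F`» is a decreasing event. -/
lemma isLowerSet_cluster_disjoint (d : V) (F : Set V) :
    IsLowerSet {ω : Config E | Disjoint (cluster ends ω d) F} := by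
  intro ω' ω h hω'
  exact Set.disjoint_of_subset_left (cluster_mono h d) hω'

/-- **The pocket-cube Harris**: for every vertex `d` and vertex set `F`,
`Σ_{ω : C_Y(d) ∩ F = ∅} σ_pq(ω) ≤ 0`. -/
theorem sum_sigma_pq_of_cluster_disjoint_nonpos (d : V) (F : Set V) (p q : V) :
    (∑ ω : Config E, if Disjoint (cluster ends ω d) F then sigma ends ω p q else 0) ≤ 0 :=
  sum_sigma_pq_of_isLowerSet_nonpos (isLowerSet_cluster_disjoint d F) p q

end Percolation

end NoPocket

end Summit.Ventures.PercRepro2
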